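import Mathlib
import HarnessLib
import Summits.NavierStokesRegularity.NavierStokesRegularity.Theorems.PoloidalWindowDoorLrcModEntireTwistingTHBranchObject

/-!
# Item `LrcModEntire` (stmt-NavierStokesRegularity-20428), skeleton twist_split v6, CLASS road to `stub_twistingTHGerm` —
# (BRANCH), second half, part 3: the scale-invariant DERIVATIVE BOUNDS of the branch object `U = (1−μ)(Θ⁺ − Θ⁻)`, `S = Θ⁺ + Θ⁻`

Cell ns-regularity-ideate, seat ns-k2-port-2 g4 (kernel-port lineage; `--supports stmt-NavierStokesRegularity-20428 --as helper`; sequel of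
`…TwistingTHBranchObject`, same INPUT blocks (TH-global) + (SD) + (BR) — see that file's docstring).  OUTPUT: the four `K`-bounds of the signed
(t,z)-object of `…TwistingTHOscRoadSigned.eq_zero_of_signedPlaneOscObject_poly`, exponent `2k`, each as `∃ K ≥ 0, ∀ t < 0, ∀ z, … ≤ K(1 + z²/(−t))^{2k}`:

* `Ut_bound` — `√(−t)(−t)|∂ₜU|` (`∂ₜU = −∂ₜμ·D + (1−μ)(∂ₜΘ⁺ − ∂ₜΘ⁻)`, `∂ₜΘ± = ∂ₜv₂(x±)`: the branch velocity drops out, `…BranchValues`);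
* `Uz_bound` — `(−t)|∂_zU|` (`∂_zΘ± = ∂₂v₂(x±)`);
* `Uzz_bound` — `√(−t)(−t)|∂_zzU|` (`∂_zzΘ± = D(∂₂v₂)(x±)[∂_z x±]`, the only place the branch slope `‖∂_z x±‖ ≤ B₁P` enters);
* `Sz_bound` — `(−t)|∂_zS|`.
Rates from `…ClassSpaceTimeRates` via `…BranchValues.branchValue_rates`; sizes from the hot spot and the slope dictionary (SD).

WHAT THIS IS NOT: not a claim about Navier–Stokes regularity and not the stub — (BR)+(SD) is the typed wall, assumed here, not proved
(bears_on LADDER-NS N0, item 20428 / crux 19708; both OPEN).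
-/

noncomputable section

-- the summit and its single sub-problem share the name (CONVENTIONS §1), as in every Theorems file
set_option linter.dupNamespace false

namespace Summit.NavierStokesRegularity.NavierStokesRegularity.Theorems.PoloidalWindowDoorLrcModEntireTwistingTHBranchBounds

open Set Function Filter Topology
open scoped RealInnerProductSpace InnerProductSpace
open Literature.Analysis Literature.Analysis.FluidPDE
open Summit.NavierStokesRegularity.NavierStokesRegularity.Theorems.PoloidalWindowDoorPoloidalWindowRigidityWindow
open Summit.NavierStokesRegularity.NavierStokesRegularity.Theorems.PoloidalWindowDoorLrcModEntireTwistingTHPlaneOscillationEnvelope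
  (differentiable_deriv_of_contDiff_two)
open Summit.NavierStokesRegularity.NavierStokesRegularity.Theorems.PoloidalWindowDoorLrcModEntireTwistingTHBranchLaw
open Summit.NavierStokesRegularity.NavierStokesRegularity.Theorems.PoloidalWindowDoorLrcModEntireTwistingTHBranchValues
open Summit.NavierStokesRegularity.NavierStokesRegularity.Theorems.PoloidalWindowDoorLrcModEntireTwistingTHBranchObject

section Class

variable {C : ℝ} {v : ℝ → EuclideanSpace ℝ (Fin 3) → EuclideanSpace ℝ (Fin 3)}
variable (hrate : HasTypeITimeDecay C v) (hcont : ContinuousOn (uncurry v) (Iio (0 : ℝ) ×ˢ univ))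
  (hmild : ∀ s t : ℝ, s < t → t < 0 → ∀ x,
    v t x = UnboundedOperators.heatExtension (v s) (t - s) x - oseenDuhamel 1 s v v t x)
  (hdiv : ∀ t < 0, VectorCalculus.IsDivFree (v t))
  (hpol : ∀ s < 0, ∀ y, ⟪curl (v s) y, EuclideanSpace.single 2 1⟫_ℝ = 0)
  {N : ℝ} (hN : ∀ t < 0, ∀ x : EuclideanSpace ℝ (Fin 3), Real.sqrt (-t) * |v t x 2| ≤ N)
  {μ : ℝ → ℝ → ℝ}
  (hTH : ∀ s < 0, ∀ y : EuclideanSpace ℝ (Fin 3), ∀ b : Fin 3, b ≠ 2 →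
    fderiv ℝ (v s) y (EuclideanSpace.single 2 1) b = μ s (y 2) * fderiv ℝ (v s) y (EuclideanSpace.single b 1) 2)
  (hμC : ContDiffOn ℝ 3 (uncurry μ) (Iio (0 : ℝ) ×ˢ univ))
  {Kμ : ℝ} {k : ℕ}
  (hμb : ∀ t < 0, ∀ z, |μ t z| ≤ Kμ * (1 + z ^ 2 / (-t)) ^ k)
  (hμt : ∀ t < 0, ∀ z, (-t) * |deriv (fun s => μ s z) t| ≤ Kμ * (1 + z ^ 2 / (-t)) ^ k)
  (hμz : ∀ t < 0, ∀ z, Real.sqrt (-t) * |deriv (μ t) z| ≤ Kμ * (1 + z ^ 2 / (-t)) ^ k)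
  (hμzz : ∀ t < 0, ∀ z, (-t) * |deriv (deriv (μ t)) z| ≤ Kμ * (1 + z ^ 2 / (-t)) ^ k)
  {xp xm : ℝ → ℝ → EuclideanSpace ℝ (Fin 3)}
  (hxp2 : ∀ t < 0, ∀ z, xp t z 2 = z) (hxm2 : ∀ t < 0, ∀ z, xm t z 2 = z)
  (hxpC : ContDiffOn ℝ 2 (uncurry xp) (Iio (0 : ℝ) ×ˢ univ)) (hxmC : ContDiffOn ℝ 2 (uncurry xm) (Iio (0 : ℝ) ×ˢ univ))
  (hmax : ∀ t < 0, ∀ z, ∀ y : EuclideanSpace ℝ (Fin 3), y 2 = z → v t y 2 ≤ v t (xp t z) 2)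
  (hmin : ∀ t < 0, ∀ z, ∀ y : EuclideanSpace ℝ (Fin 3), y 2 = z → v t (xm t z) 2 ≤ v t y 2)
  {B₁ : ℝ}
  (hxpz : ∀ t < 0, ∀ z, ‖deriv (xp t) z‖ ≤ B₁ * (1 + z ^ 2 / (-t)) ^ k)
  (hxmz : ∀ t < 0, ∀ z, ‖deriv (xm t) z‖ ≤ B₁ * (1 + z ^ 2 / (-t)) ^ k)
  {U S : ℝ → ℝ → ℝ}
  (hU : U = fun s h => (1 - μ s h) * (v s (xp s h) 2 - v s (xm s h) 2))
  (hS : S = fun s h => v s (xp s h) 2 + v s (xm s h) 2)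

include hrate hcont hmild hdiv

include hN hμC hμb hμt hxp2 hxm2 hxpC hxmC hmax hmin hU in
/-- **Time-derivative bound**: `∃ K ≥ 0`, `√(−t)(−t)|∂ₜU(t,z)| ≤ K(1 + z²/(−t))^{2k}` (`∂ₜU = −∂ₜμ·D + (1−μ)(∂ₜΘ⁺ − ∂ₜΘ⁻)`, `∂ₜΘ± = ∂ₜv₂(x±)`). -/
theorem Ut_bound : ∃ K : ℝ, 0 ≤ K ∧ ∀ t < 0, ∀ z,
    Real.sqrt (-t) * (-t) * |fderiv ℝ (uncurry U) (t, z) (1, 0)| ≤ K * (1 + z ^ 2 / (-t)) ^ (2 * k) := by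
  have hcritp := crit_max hrate hcont hmild hdiv hxp2 hmax
  have hcritm := crit_min hrate hcont hmild hdiv hxm2 hmin
  obtain ⟨Kp, hKp0, hpt, -, -⟩ := branchValue_rates hrate hcont hmild hdiv hxp2 hxpC hcritp
  obtain ⟨Km, hKm0, hmt, -, -⟩ := branchValue_rates hrate hcont hmild hdiv hxm2 hxmC hcritm
  obtain ⟨hKμ0, -⟩ := slope_facts hμb (by norm_num : (-1:ℝ) < 0) 0
  obtain ⟨hN0, -, -⟩ := osc_facts hN hxm2 hmax (by norm_num : (-1:ℝ) < 0) 0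
  have hUC := contDiffOn_U hrate hcont hmild hdiv hμC hxpC hxmC hU
  refine ⟨2 * N * Kμ + (1 + Kμ) * (Kp + Km), by positivity, fun t ht z => ?_⟩
  have hnt : 0 < -t := neg_pos.2 ht
  have hs : 0 ≤ Real.sqrt (-t) := Real.sqrt_nonneg _
  obtain ⟨-, hD0, hD⟩ := osc_facts hN hxm2 hmax ht z
  obtain ⟨-, ha⟩ := slope_facts hμb ht z
  obtain ⟨hP1, hPP, -⟩ := poly_facts ht z k
  set P := (1 + z ^ 2 / (-t)) ^ k
  have hP0 : 0 ≤ P := zero_le_one.trans hP1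
  have hKP : 0 ≤ Kμ * P := mul_nonneg hKμ0 hP0
  -- the time derivative of `U(·,z)` at `t`
  have hμs : HasDerivAt (fun s => μ s z) (deriv (fun s => μ s z) t) t := (differentiableAt_timeSlice hμC (by simp) ht z).hasDerivAt
  have hΘps := hasDerivAt_branchValue_time hrate hcont hmild hdiv hxp2 hxpC hcritp ht z
  have hΘms := hasDerivAt_branchValue_time hrate hcont hmild hdiv hxm2 hxmC hcritm ht z
  have hUs : HasDerivAt (fun s => U s z)
      (-deriv (fun s => μ s z) t * (v t (xp t z) 2 - v t (xm t z) 2) +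
        (1 - μ t z) * (deriv (fun s => v s (xp t z) 2) t - deriv (fun s => v s (xm t z) 2) t)) t := by
    subst hU
    exact ((hμs.const_sub 1).mul (hΘps.sub hΘms)).congr_deriv (by simp only [Pi.sub_apply])
  have hUd : HasFDerivAt (uncurry U) (fderiv ℝ (uncurry U) (t, z)) (t, z) :=
    ((hUC.differentiableOn (by norm_num)).differentiableAt (slab_mem_nhds ht z)).hasFDerivAt
  rw [(hasDerivAt_time_of_hasFDerivAt hUd).unique hUs]
  have hp1 := hpt t ht z
  have hm1 := hmt t ht z
  rw [hΘps.deriv] at hp1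
  rw [hΘms.deriv] at hm1
  have hμt' := hμt t ht z
  set μt := deriv (fun s => μ s z) t
  set D := v t (xp t z) 2 - v t (xm t z) 2
  set a := 1 - μ t z
  set Tp := deriv (fun s => v s (xp t z) 2) t
  set Tm := deriv (fun s => v s (xm t z) 2) t
  have e1 : Real.sqrt (-t) * (-t) * |(-μt) * D| = ((-t) * |μt|) * (Real.sqrt (-t) * D) := by
    rw [abs_mul, abs_neg, abs_of_nonneg hD0]; ring
  have e2 : Real.sqrt (-t) * (-t) * |a * (Tp - Tm)| = |a| * ((-t) * Real.sqrt (-t) * |Tp - Tm|) := by rw [abs_mul]; ring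
  have b1 : ((-t) * |μt|) * (Real.sqrt (-t) * D) ≤ Kμ * P * (2 * N) := mul_le_mul hμt' hD (mul_nonneg hs hD0) hKP
  have h3 : (-t) * Real.sqrt (-t) * |Tp - Tm| ≤ Kp + Km :=
    calc (-t) * Real.sqrt (-t) * |Tp - Tm| ≤ (-t) * Real.sqrt (-t) * (|Tp| + |Tm|) :=
          mul_le_mul_of_nonneg_left (abs_sub _ _) (mul_nonneg hnt.le hs)
      _ = (-t) * Real.sqrt (-t) * |Tp| + (-t) * Real.sqrt (-t) * |Tm| := by ring
      _ ≤ Kp + Km := add_le_add hp1 hm1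
  have b2 : |a| * ((-t) * Real.sqrt (-t) * |Tp - Tm|) ≤ (1 + Kμ * P) * (Kp + Km) :=
    mul_le_mul ha h3 (mul_nonneg (mul_nonneg hnt.le hs) (abs_nonneg _)) (add_nonneg zero_le_one hKP)
  have h1 : Real.sqrt (-t) * (-t) * |(-μt) * D + a * (Tp - Tm)| ≤ Kμ * P * (2 * N) + (1 + Kμ * P) * (Kp + Km) := by
    calc Real.sqrt (-t) * (-t) * |(-μt) * D + a * (Tp - Tm)|
        ≤ Real.sqrt (-t) * (-t) * (|(-μt) * D| + |a * (Tp - Tm)|) := mul_le_mul_of_nonneg_left (abs_add_le _ _) (mul_nonneg hs hnt.le)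
      _ = Real.sqrt (-t) * (-t) * |(-μt) * D| + Real.sqrt (-t) * (-t) * |a * (Tp - Tm)| := by ring
      _ ≤ Kμ * P * (2 * N) + (1 + Kμ * P) * (Kp + Km) := by rw [e1, e2]; exact add_le_add b1 b2
  have h2 : Kμ * P * (2 * N) + (1 + Kμ * P) * (Kp + Km) ≤ (2 * N * Kμ + (1 + Kμ) * (Kp + Km)) * P := by
    have e : (2 * N * Kμ + (1 + Kμ) * (Kp + Km)) * P - (Kμ * P * (2 * N) + (1 + Kμ * P) * (Kp + Km)) = (Kp + Km) * (P - 1) := by ring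
    rw [← sub_nonneg, e]; exact mul_nonneg (add_nonneg hKp0 hKm0) (sub_nonneg.2 hP1)
  exact le_mul_of_le_mul (h1.trans h2) le_rfl hPP hP0 (by positivity)

include hN hμC hμb hμz hxp2 hxm2 hxpC hxmC hmax hmin hU in
/-- **Height-derivative bound**: `∃ K ≥ 0`, `(−t)|∂_zU(t,z)| ≤ K(1 + z²/(−t))^{2k}` (`∂_zU = −∂_zμ·D + (1−μ)(∂₂v₂(x⁺) − ∂₂v₂(x⁻))`). -/
theorem Uz_bound : ∃ K : ℝ, 0 ≤ K ∧ ∀ t < 0, ∀ z, (-t) * |deriv (U t) z| ≤ K * (1 + z ^ 2 / (-t)) ^ (2 * k) := by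
  have hcritp := crit_max hrate hcont hmild hdiv hxp2 hmax
  have hcritm := crit_min hrate hcont hmild hdiv hxm2 hmin
  have hΘpC := contDiffOn_branchValue hrate hcont hmild hdiv hxpC
  have hΘmC := contDiffOn_branchValue hrate hcont hmild hdiv hxmC
  obtain ⟨Kp, hKp0, -, hpz, -⟩ := branchValue_rates hrate hcont hmild hdiv hxp2 hxpC hcritp
  obtain ⟨Km, hKm0, -, hmz, -⟩ := branchValue_rates hrate hcont hmild hdiv hxm2 hxmC hcritm
  obtain ⟨hKμ0, -⟩ := slope_facts hμb (by norm_num : (-1:ℝ) < 0) 0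
  obtain ⟨hN0, -, -⟩ := osc_facts hN hxm2 hmax (by norm_num : (-1:ℝ) < 0) 0
  refine ⟨2 * N * Kμ + (1 + Kμ) * (Kp + Km), by positivity, fun t ht z => ?_⟩
  have hnt : 0 < -t := neg_pos.2 ht
  have hs : 0 ≤ Real.sqrt (-t) := Real.sqrt_nonneg _
  have hst : Real.sqrt (-t) * Real.sqrt (-t) = -t := Real.mul_self_sqrt hnt.le
  obtain ⟨-, hD0, hD⟩ := osc_facts hN hxm2 hmax ht z
  obtain ⟨-, ha⟩ := slope_facts hμb ht z
  obtain ⟨hP1, hPP, -⟩ := poly_facts ht z k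
  set P := (1 + z ^ 2 / (-t)) ^ k
  have hP0 : 0 ≤ P := zero_le_one.trans hP1
  have hKP : 0 ≤ Kμ * P := mul_nonneg hKμ0 hP0
  -- `∂_zU` by the product rule
  have hμt2 : ContDiff ℝ 2 (μ t) := (contDiff_heightSlice hμC ht).of_le (by norm_cast)
  have haC : ContDiff ℝ 2 (fun h => 1 - μ t h) := contDiff_const.sub hμt2
  have hΘpt := contDiff_heightSlice hΘpC ht
  have hΘmt := contDiff_heightSlice hΘmC ht
  have eU : U t = fun h => (1 - μ t h) * (v t (xp t h) 2 - v t (xm t h) 2) := by rw [hU]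
  obtain ⟨d1, -⟩ := deriv_mul_two haC (hΘpt.sub hΘmt) z
  rw [eU, d1, deriv_const_sub, deriv_fun_sub (hΘpt.differentiable (by norm_num) z) (hΘmt.differentiable (by norm_num) z)]
  have hp1 := hpz t ht z
  have hm1 := hmz t ht z
  have hμz' := hμz t ht z
  set μ1 := deriv (μ t) z
  set D := v t (xp t z) 2 - v t (xm t z) 2
  set a := 1 - μ t z
  set Zp := deriv (fun z' => v t (xp t z') 2) z
  set Zm := deriv (fun z' => v t (xm t z') 2) z
  have e1 : (-t) * |(-μ1) * D| = (Real.sqrt (-t) * |μ1|) * (Real.sqrt (-t) * D) := by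
    rw [abs_mul, abs_neg, abs_of_nonneg hD0,
      show (Real.sqrt (-t) * |μ1|) * (Real.sqrt (-t) * D) = (Real.sqrt (-t) * Real.sqrt (-t)) * (|μ1| * D) by ring, hst]
  have e2 : (-t) * |a * (Zp - Zm)| = |a| * ((-t) * |Zp - Zm|) := by rw [abs_mul]; ring
  have b1 : (Real.sqrt (-t) * |μ1|) * (Real.sqrt (-t) * D) ≤ Kμ * P * (2 * N) := mul_le_mul hμz' hD (mul_nonneg hs hD0) hKP
  have h3 : (-t) * |Zp - Zm| ≤ Kp + Km :=
    calc (-t) * |Zp - Zm| ≤ (-t) * (|Zp| + |Zm|) := mul_le_mul_of_nonneg_left (abs_sub _ _) hnt.le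
      _ = (-t) * |Zp| + (-t) * |Zm| := by ring
      _ ≤ Kp + Km := add_le_add hp1 hm1
  have b2 : |a| * ((-t) * |Zp - Zm|) ≤ (1 + Kμ * P) * (Kp + Km) :=
    mul_le_mul ha h3 (mul_nonneg hnt.le (abs_nonneg _)) (add_nonneg zero_le_one hKP)
  have h1 : (-t) * |(-μ1) * D + a * (Zp - Zm)| ≤ Kμ * P * (2 * N) + (1 + Kμ * P) * (Kp + Km) := by
    calc (-t) * |(-μ1) * D + a * (Zp - Zm)| ≤ (-t) * (|(-μ1) * D| + |a * (Zp - Zm)|) :=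
          mul_le_mul_of_nonneg_left (abs_add_le _ _) hnt.le
      _ = (-t) * |(-μ1) * D| + (-t) * |a * (Zp - Zm)| := by ring
      _ ≤ Kμ * P * (2 * N) + (1 + Kμ * P) * (Kp + Km) := by rw [e1, e2]; exact add_le_add b1 b2
  have h2 : Kμ * P * (2 * N) + (1 + Kμ * P) * (Kp + Km) ≤ (2 * N * Kμ + (1 + Kμ) * (Kp + Km)) * P := by
    have e : (2 * N * Kμ + (1 + Kμ) * (Kp + Km)) * P - (Kμ * P * (2 * N) + (1 + Kμ * P) * (Kp + Km)) = (Kp + Km) * (P - 1) := by ring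
    rw [← sub_nonneg, e]; exact mul_nonneg (add_nonneg hKp0 hKm0) (sub_nonneg.2 hP1)
  exact le_mul_of_le_mul (h1.trans h2) le_rfl hPP hP0 (by positivity)

include hN hμC hμb hμz hμzz hxp2 hxm2 hxpC hxmC hmax hmin hxpz hxmz hU in
/-- **Second height-derivative bound**: `∃ K ≥ 0`, `√(−t)(−t)|∂_zzU(t,z)| ≤ K(1 + z²/(−t))^{2k}`
(`∂_zzU = −∂_zzμ·D − 2∂_zμ·∂_zD + (1−μ)∂_zzD`, `∂_zzΘ± = D(∂₂v₂)(x±)[∂_z x±]`). -/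
theorem Uzz_bound : ∃ K : ℝ, 0 ≤ K ∧ ∀ t < 0, ∀ z,
    Real.sqrt (-t) * (-t) * |deriv (deriv (U t)) z| ≤ K * (1 + z ^ 2 / (-t)) ^ (2 * k) := by
  have hcritp := crit_max hrate hcont hmild hdiv hxp2 hmax
  have hcritm := crit_min hrate hcont hmild hdiv hxm2 hmin
  have hΘpC := contDiffOn_branchValue hrate hcont hmild hdiv hxpC
  have hΘmC := contDiffOn_branchValue hrate hcont hmild hdiv hxmC
  obtain ⟨Kp, hKp0, -, hpz, hpzz⟩ := branchValue_rates hrate hcont hmild hdiv hxp2 hxpC hcritp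
  obtain ⟨Km, hKm0, -, hmz, hmzz⟩ := branchValue_rates hrate hcont hmild hdiv hxm2 hxmC hcritm
  obtain ⟨hKμ0, -⟩ := slope_facts hμb (by norm_num : (-1:ℝ) < 0) 0
  obtain ⟨hN0, -, -⟩ := osc_facts hN hxm2 hmax (by norm_num : (-1:ℝ) < 0) 0
  have hB0 : 0 ≤ B₁ := by
    have h := hxpz (-1) (by norm_num) 0
    have e : (1 + (0:ℝ) ^ 2 / (-(-1:ℝ))) ^ k = 1 := by simp
    rw [e, mul_one] at h
    exact (norm_nonneg _).trans h
  set M : ℝ := Kp + Km with hM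
  have hM0 : 0 ≤ M := add_nonneg hKp0 hKm0
  refine ⟨2 * N * Kμ + 2 * Kμ * M + (1 + Kμ) * M * B₁, by positivity, fun t ht z => ?_⟩
  have hnt : 0 < -t := neg_pos.2 ht
  have hs : 0 ≤ Real.sqrt (-t) := Real.sqrt_nonneg _
  obtain ⟨-, hD0, hD⟩ := osc_facts hN hxm2 hmax ht z
  obtain ⟨-, ha⟩ := slope_facts hμb ht z
  obtain ⟨hP1, -, hP2⟩ := poly_facts ht z k
  rw [hP2]
  set P := (1 + z ^ 2 / (-t)) ^ k
  have hP0 : 0 ≤ P := zero_le_one.trans hP1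
  have hKP : 0 ≤ Kμ * P := mul_nonneg hKμ0 hP0
  -- `∂_zzU` by the product rule
  have hμt3 : ContDiff ℝ 3 (μ t) := contDiff_heightSlice hμC ht
  have hμt2 : ContDiff ℝ 2 (μ t) := hμt3.of_le (by norm_cast)
  have hΘpt := contDiff_heightSlice hΘpC ht
  have hΘmt := contDiff_heightSlice hΘmC ht
  have hpd : Differentiable ℝ (fun h => v t (xp t h) 2) := hΘpt.differentiable (by norm_num)
  have hmd : Differentiable ℝ (fun h => v t (xm t h) 2) := hΘmt.differentiable (by norm_num)
  have haC : ContDiff ℝ 2 (fun h => 1 - μ t h) := contDiff_const.sub hμt2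
  have eU : U t = fun h => (1 - μ t h) * (v t (xp t h) 2 - v t (xm t h) 2) := by rw [hU]
  obtain ⟨-, d2⟩ := deriv_mul_two haC (hΘpt.sub hΘmt) z
  have ea1 : deriv (fun h => 1 - μ t h) = fun h => -deriv (μ t) h := funext fun h => deriv_const_sub _
  have ea2 : deriv (deriv fun h => 1 - μ t h) z = -deriv (deriv (μ t)) z := by rw [ea1, deriv.fun_neg]
  have ef1 : deriv (fun h => v t (xp t h) 2 - v t (xm t h) 2) =
      fun h => deriv (fun h => v t (xp t h) 2) h - deriv (fun h => v t (xm t h) 2) h := funext fun h => deriv_fun_sub (hpd h) (hmd h)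
  have ef2 : deriv (deriv fun h => v t (xp t h) 2 - v t (xm t h) 2) z =
      deriv (deriv fun h => v t (xp t h) 2) z - deriv (deriv fun h => v t (xm t h) 2) z := by
    rw [ef1]; exact deriv_fun_sub (differentiable_deriv_of_contDiff_two hΘpt z) (differentiable_deriv_of_contDiff_two hΘmt z)
  rw [eU, d2, ea2, ef2, show deriv (fun h => 1 - μ t h) z = -deriv (μ t) z from deriv_const_sub _,
    show deriv (fun h => v t (xp t h) 2 - v t (xm t h) 2) z = deriv (fun h => v t (xp t h) 2) z - deriv (fun h => v t (xm t h) 2) z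
      from deriv_fun_sub (hpd z) (hmd z)]
  have hp1 := hpz t ht z
  have hm1 := hmz t ht z
  have hp2 := hpzz t ht z
  have hm2 := hmzz t ht z
  have hμz' := hμz t ht z
  have hμzz' := hμzz t ht z
  have hbp := hxpz t ht z
  have hbm := hxmz t ht z
  set μ1 := deriv (μ t) z
  set μ2 := deriv (deriv (μ t)) z
  set D := v t (xp t z) 2 - v t (xm t z) 2
  set a := 1 - μ t z
  set Zp := deriv (fun z' => v t (xp t z') 2) z
  set Zm := deriv (fun z' => v t (xm t z') 2) z
  set ZZp := deriv (deriv fun z' => v t (xp t z') 2) z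
  set ZZm := deriv (deriv fun z' => v t (xm t z') 2) z
  have e1 : Real.sqrt (-t) * (-t) * |(-μ2) * D| = ((-t) * |μ2|) * (Real.sqrt (-t) * D) := by
    rw [abs_mul, abs_neg, abs_of_nonneg hD0]; ring
  have e2 : Real.sqrt (-t) * (-t) * |2 * (-μ1) * (Zp - Zm)| = 2 * ((Real.sqrt (-t) * |μ1|) * ((-t) * |Zp - Zm|)) := by
    rw [abs_mul, abs_mul, abs_neg, abs_two]; ring
  have e3 : Real.sqrt (-t) * (-t) * |a * (ZZp - ZZm)| = |a| * ((-t) * Real.sqrt (-t) * |ZZp - ZZm|) := by rw [abs_mul]; ring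
  have b1 : ((-t) * |μ2|) * (Real.sqrt (-t) * D) ≤ Kμ * P * (2 * N) := mul_le_mul hμzz' hD (mul_nonneg hs hD0) hKP
  have h3 : (-t) * |Zp - Zm| ≤ M :=
    calc (-t) * |Zp - Zm| ≤ (-t) * (|Zp| + |Zm|) := mul_le_mul_of_nonneg_left (abs_sub _ _) hnt.le
      _ = (-t) * |Zp| + (-t) * |Zm| := by ring
      _ ≤ Kp + Km := add_le_add hp1 hm1
  have b2 : (Real.sqrt (-t) * |μ1|) * ((-t) * |Zp - Zm|) ≤ (Kμ * P) * M := mul_le_mul hμz' h3 (mul_nonneg hnt.le (abs_nonneg _)) hKP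
  have h4 : (-t) * Real.sqrt (-t) * |ZZp - ZZm| ≤ M * (B₁ * P) := by
    have h5 : (-t) * Real.sqrt (-t) * |ZZp| ≤ Kp * (B₁ * P) := hp2.trans (mul_le_mul_of_nonneg_left hbp hKp0)
    have h6 : (-t) * Real.sqrt (-t) * |ZZm| ≤ Km * (B₁ * P) := hm2.trans (mul_le_mul_of_nonneg_left hbm hKm0)
    calc (-t) * Real.sqrt (-t) * |ZZp - ZZm| ≤ (-t) * Real.sqrt (-t) * (|ZZp| + |ZZm|) :=
          mul_le_mul_of_nonneg_left (abs_sub _ _) (mul_nonneg hnt.le hs)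
      _ = (-t) * Real.sqrt (-t) * |ZZp| + (-t) * Real.sqrt (-t) * |ZZm| := by ring
      _ ≤ Kp * (B₁ * P) + Km * (B₁ * P) := add_le_add h5 h6
      _ = M * (B₁ * P) := by simp only [hM]; ring
  have b3 : |a| * ((-t) * Real.sqrt (-t) * |ZZp - ZZm|) ≤ (1 + Kμ * P) * (M * (B₁ * P)) :=
    mul_le_mul ha h4 (mul_nonneg (mul_nonneg hnt.le hs) (abs_nonneg _)) (add_nonneg zero_le_one hKP)
  have h1 : Real.sqrt (-t) * (-t) * |(-μ2) * D + 2 * (-μ1) * (Zp - Zm) + a * (ZZp - ZZm)| ≤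
      Kμ * P * (2 * N) + 2 * ((Kμ * P) * M) + (1 + Kμ * P) * (M * (B₁ * P)) := by
    calc Real.sqrt (-t) * (-t) * |(-μ2) * D + 2 * (-μ1) * (Zp - Zm) + a * (ZZp - ZZm)|
        ≤ Real.sqrt (-t) * (-t) * (|(-μ2) * D| + |2 * (-μ1) * (Zp - Zm)| + |a * (ZZp - ZZm)|) :=
          mul_le_mul_of_nonneg_left ((abs_add_le _ _).trans (add_le_add (abs_add_le _ _) le_rfl)) (mul_nonneg hs hnt.le)
      _ = Real.sqrt (-t) * (-t) * |(-μ2) * D| + Real.sqrt (-t) * (-t) * |2 * (-μ1) * (Zp - Zm)| +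
            Real.sqrt (-t) * (-t) * |a * (ZZp - ZZm)| := by ring
      _ ≤ Kμ * P * (2 * N) + 2 * ((Kμ * P) * M) + (1 + Kμ * P) * (M * (B₁ * P)) := by
          rw [e1, e2, e3]; exact add_le_add (add_le_add b1 (mul_le_mul_of_nonneg_left b2 zero_le_two)) b3
  have h2 : Kμ * P * (2 * N) + 2 * ((Kμ * P) * M) + (1 + Kμ * P) * (M * (B₁ * P)) ≤
      (2 * N * Kμ + 2 * Kμ * M + (1 + Kμ) * M * B₁) * (P * P) := by
    have hPP' : 0 ≤ P * P - P := sub_nonneg.2 (le_mul_of_one_le_right hP0 hP1)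
    have e : (2 * N * Kμ + 2 * Kμ * M + (1 + Kμ) * M * B₁) * (P * P)
        - (Kμ * P * (2 * N) + 2 * ((Kμ * P) * M) + (1 + Kμ * P) * (M * (B₁ * P))) = (2 * N * Kμ + 2 * Kμ * M + M * B₁) * (P * P - P) := by ring
    have hc : 0 ≤ 2 * N * Kμ + 2 * Kμ * M + M * B₁ :=
      add_nonneg (add_nonneg (mul_nonneg (mul_nonneg zero_le_two hN0) hKμ0) (mul_nonneg (mul_nonneg zero_le_two hKμ0) hM0)) (mul_nonneg hM0 hB0)
    rw [← sub_nonneg, e]; exact mul_nonneg hc hPP'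
  exact h1.trans h2

include hxp2 hxm2 hxpC hxmC hmax hmin hS in
/-- **Height-derivative bound for `S`**: `∃ K ≥ 0`, `(−t)|∂_zS(t,z)| ≤ K(1 + z²/(−t))^{2k}`. -/
theorem Sz_bound : ∃ K : ℝ, 0 ≤ K ∧ ∀ t < 0, ∀ z, (-t) * |deriv (S t) z| ≤ K * (1 + z ^ 2 / (-t)) ^ (2 * k) := by
  have hcritp := crit_max hrate hcont hmild hdiv hxp2 hmax
  have hcritm := crit_min hrate hcont hmild hdiv hxm2 hmin
  have hΘpC := contDiffOn_branchValue hrate hcont hmild hdiv hxpC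
  have hΘmC := contDiffOn_branchValue hrate hcont hmild hdiv hxmC
  obtain ⟨Kp, hKp0, -, hpz, -⟩ := branchValue_rates hrate hcont hmild hdiv hxp2 hxpC hcritp
  obtain ⟨Km, hKm0, -, hmz, -⟩ := branchValue_rates hrate hcont hmild hdiv hxm2 hxmC hcritm
  refine ⟨Kp + Km, add_nonneg hKp0 hKm0, fun t ht z => ?_⟩
  have hnt : 0 < -t := neg_pos.2 ht
  obtain ⟨hP1, hPP, -⟩ := poly_facts ht z k
  have eS : S t = fun h => v t (xp t h) 2 + v t (xm t h) 2 := by subst hS; rfl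
  rw [eS, deriv_fun_add ((contDiff_heightSlice hΘpC ht).differentiable (by norm_num) z)
    ((contDiff_heightSlice hΘmC ht).differentiable (by norm_num) z)]
  have hp1 := hpz t ht z
  have hm1 := hmz t ht z
  have h1 : (-t) * |deriv (fun z' => v t (xp t z') 2) z + deriv (fun z' => v t (xm t z') 2) z| ≤ (Kp + Km) * 1 :=
    calc (-t) * |deriv (fun z' => v t (xp t z') 2) z + deriv (fun z' => v t (xm t z') 2) z|
        ≤ (-t) * (|deriv (fun z' => v t (xp t z') 2) z| + |deriv (fun z' => v t (xm t z') 2) z|) :=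
          mul_le_mul_of_nonneg_left (abs_add_le _ _) hnt.le
      _ = (-t) * |deriv (fun z' => v t (xp t z') 2) z| + (-t) * |deriv (fun z' => v t (xm t z') 2) z| := by ring
      _ ≤ Kp + Km := add_le_add hp1 hm1
      _ = (Kp + Km) * 1 := (mul_one _).symm
  exact le_mul_of_le_mul h1 le_rfl (hP1.trans hPP) zero_le_one (add_nonneg hKp0 hKm0)

end Class

end Summit.NavierStokesRegularity.NavierStokesRegularity.Theorems.PoloidalWindowDoorLrcModEntireTwistingTHBranchBounds
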